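import Summits.RiemannHypothesis.RiemannHypothesis.Theses.WeilSemilocal
import Summits.RiemannHypothesis.RiemannHypothesis.Theorems.SemilocalClassLaw
import Summits.RiemannHypothesis.RiemannHypothesis.Theorems.WeilSemilocalRowsHeadTheta
import Summits.RiemannHypothesis.RiemannHypothesis.Theorems.SemilocalNegCertUptoNinetySevenKinkedFinal
import Summits.RiemannHypothesis.RiemannHypothesis.Theorems.SemilocalNegCertUptoHundredThreeKinkedFinal
import Summits.RiemannHypothesis.RiemannHypothesis.Theorems.SemilocalNegCertUptoHundredThirtyOneKinkedFinal
import Summits.RiemannHypothesis.RiemannHypothesis.Theorems.SemilocalNegCertUptoHundredThirtyNineKinkedFinal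
import HarnessLib

/-!
# Route `WeilSemilocal` — the support item `SemilocalRowsToOneFiftySeven` (stmt-RiemannHypothesis-19396) CLOSED (RH-FREE, kernel)

Item stmt-RiemannHypothesis-19396 of `route-RiemannHypothesis-WeilSemilocal`: C-I(a) at the fourteen primes `80 ≤ q < 157` — for
every prime `q'` above `q`, `a*(S_q) = weilSemilocalThreshold (Nat.primesBelow q) < (log q')/2`.  Assembly of tree theorems only:
the TEN rows of gap `≥ 4` (`q = 83, 89, 97, 103, 109, 113, 127, 131, 139, 151`) are weil-1's tier-1 theta kernel certificates
`WeilSemilocalRoute.thetaHead_walls` (`WeilSemilocalRowsHeadTheta`, p442040), and the FOUR LOWER TWINS are the kinked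
(piecewise-cubic) K-cell negativity certificates of cc-s2-4 gen11–14: `q = 107` (`SemilocalPolyWitness.weilSemilocalThreshold_uptoHundredThree_lt_log_hundrednine_half`,
p431xxx lineage), and — filed by cc-s2-10 — `q = 101` (`…uptoNinetySeven_lt_log_hundredthree_half`: `a*({2,…,97}) ≤ 593/256 < (log 103)/2`,
p455753), `q = 137` (`…uptoHundredThirtyOne_lt_log_hundredthirtynine_half`: `a*({2,…,131}) ≤ 1263/512 < (log 139)/2`, p455309),
`q = 149` (`…uptoHundredThirtyNine_lt_log_hundredfiftyone_half`: `a*({2,…,139}) ≤ 321/128 < (log 151)/2`, p467625), each packaged in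
cc-s2-1's `SemilocalClassLawAt` currency by `SemilocalClassLaw.semilocalClassLawAt_of_eq` (pattern of `semilocalClassLawAt_seventythree`).
The 77-way case split is the one of weil-1's `semilocalRowsToOneFiftySeven_of_twins` (`WeilSemilocalRowsToOneFiftySevenOfTwins`, p45xxxx;
restated here with the three twin hypotheses discharged so that this closer imports the route file and route-independent modules only).
UPPER clauses of TRUNCATED Weil forms (cell `rh-explicit`, LADDER-RH rung W-P(P2)); nothing here bears on the truth of RH.
-/

set_option linter.dupNamespace false  -- the mandated namespace repeats `RiemannHypothesis`

namespace Summit.RiemannHypothesis.RiemannHypothesis.Theorems.WeilSemilocalRoute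

open Summit.RiemannHypothesis.RiemannHypothesis.Theorems.SemilocalClassLaw
open Summit.RiemannHypothesis.RiemannHypothesis.Theorems.SemilocalPolyWitness

set_option maxRecDepth 8000 in  -- `Nat.primesBelow 101 = {2, …, 97}` by `decide`
/-- `q = 101` (lower twin, `q⁺ = 103`): C-I(a) at `101`, i.e. `a*(S_101) < (log q')/2` for every prime `q' > 101`, from the kinked
K-cell wall `a*({2,…,97}) ≤ 593/256 < (log 103)/2`. [tree certificate `SemilocalNegCertUptoNinetySevenKinkedFinal`; RH-FREE] -/
theorem semilocalClassLawAt_hundredone : SemilocalClassLawAt 101 :=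
  semilocalClassLawAt_of_eq (Q := 103) (by decide) (fun m h1 h2 ↦ by interval_cases m; decide)
    weilSemilocalThreshold_uptoNinetySeven_lt_log_hundredthree_half

set_option maxRecDepth 8000 in  -- `Nat.primesBelow 137 = {2, …, 131}` by `decide`
/-- `q = 137` (lower twin, `q⁺ = 139`): C-I(a) at `137`, from the kinked K-cell wall `a*({2,…,131}) ≤ 1263/512 < (log 139)/2`.
[tree certificate `SemilocalNegCertUptoHundredThirtyOneKinkedFinal`; RH-FREE] -/
theorem semilocalClassLawAt_hundredthirtyseven : SemilocalClassLawAt 137 :=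
  semilocalClassLawAt_of_eq (Q := 139) (by decide) (fun m h1 h2 ↦ by interval_cases m; decide)
    weilSemilocalThreshold_uptoHundredThirtyOne_lt_log_hundredthirtynine_half

set_option maxRecDepth 8000 in  -- `Nat.primesBelow 149 = {2, …, 139}` by `decide`
/-- `q = 149` (lower twin, `q⁺ = 151`): C-I(a) at `149`, from the kinked K-cell wall `a*({2,…,139}) ≤ 321/128 < (log 151)/2`.
[tree certificate `SemilocalNegCertUptoHundredThirtyNineKinkedFinal`; RH-FREE] -/
theorem semilocalClassLawAt_hundredfortynine : SemilocalClassLawAt 149 :=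
  semilocalClassLawAt_of_eq (Q := 151) (by decide) (fun m h1 h2 ↦ by interval_cases m; decide)
    weilSemilocalThreshold_uptoHundredThirtyNine_lt_log_hundredfiftyone_half

set_option maxRecDepth 8000 in
set_option maxHeartbeats 800000 in  -- 77-way `interval_cases` on `80 ≤ q < 157` (as in weil-1's `semilocalRowsToOneFiftySeven_of_twins`)
/-- **Item stmt-RiemannHypothesis-19396 `SemilocalRowsToOneFiftySeven`** (route `WeilSemilocal`, support, rank 9): C-I(a) at the
fourteen primes `80 ≤ q < 157` — the ten gap-`≥ 4` rows by `thetaHead_walls`, the four lower twins `101, 107, 137, 149` by their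
kinked K-cell walls. [this cell; RH-FREE upper clauses of truncated Weil forms; thresholds as in Yoshida 1992 Prop. 6] -/
theorem semilocalRowsToOneFiftySeven_proof :
    Summit.RiemannHypothesis.RiemannHypothesis.Theses.WeilSemilocal.SemilocalRowsToOneFiftySeven := by
  have h101 := semilocalClassLawAt_hundredone
  -- `q = 107`: the kinked K-cell wall `a*({2,…,103}) ≤ 2401/1024 < (log 109)/2` (weil-1's `semilocalClassLawAt_hundredseven` lives in
  -- a module of the route file's import cone, so the instance is re-derived locally, as in `semilocalRowsToOneFiftySeven_of_twins`)
  have h107 : SemilocalClassLawAt 107 :=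
    semilocalClassLawAt_of_eq (Q := 109) (by decide) (fun m h1 h2 ↦ by interval_cases m; decide)
      weilSemilocalThreshold_uptoHundredThree_lt_log_hundrednine_half
  have h137 := semilocalClassLawAt_hundredthirtyseven
  have h149 := semilocalClassLawAt_hundredfortynine
  have hθ := thetaHead_walls
  unfold Theses.WeilSemilocal.SemilocalRowsToOneFiftySeven
  intro q hq h80 h157
  interval_cases q <;> first
    | exact absurd hq (by decide)
    | exact hθ _ (by decide)
    | exact h101 | exact h107 | exact h137 | exact h149

end Summit.RiemannHypothesis.RiemannHypothesis.Theorems.WeilSemilocalRoute
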